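import Mathlib
import HarnessLib

/-!
# The transfer-matrix identity of the small-subgraph-conditioning constants (Sly 2010, Lemma 3.8)

Allan Sly, *Computational transition at the uniqueness threshold*, FOCS 2010 (arXiv:1005.5584), §3.2
(Lemma 3.8, after MWW09 Lemma 7.4).

In the planted factorial moments `E[Y [X_i]_m]/E Y → (λ_i (1+δ_i))^m`, the factor `1 + δ_i`,
`δ_i = (αβ/((1-α)(1-β)))^{i/2}`, arises as a weighted sum over the vertex 2-colourings of a rooted
`i`-cycle with no two adjacent occupied vertices: asymptotically each colouring contributes
`c^{i/2} u^{j₊} v^{j₋}` with `u = α(1-α)/(1-α-β)²`, `v = β(1-β)/(1-α-β)²`,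
`c = (1-α-β)²/((1-α)(1-β))`. This file proves the resulting identity EXACTLY:

* `slyCycleSum u v j`: the cyclic hard-core sum of the `2j`-cycle (product form);
* `slyCycleSum_eq_trace`, `slyPathSum_eq_slyP`: it is the trace of the `j`-th power of the `2×2`
  transfer matrix `N = [[1+v, u], [1, u]]` (`slyN`, `slyP`);
* `slyTransfer_trace`: `tr N = 1+u+v`, `det N = uv`, so if `c(1+u+v) = 1+ρ` and `c²uv = ρ` then
  `c^j tr(N^j) = 1 + ρ^j` (Cayley–Hamilton recursion);
* `slyCycleSum_identity`: hence `c^j · CycleSum_j = 1 + ρ^j`; `sly_transfer_constants` checks the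
  two relations for Sly's `u, v, c` with `ρ = αβ/((1-α)(1-β))`, i.e. `1 + ρ^{i/2} = 1 + δ_i`.

No named facts. [cite: Sly2010, Lemma 3.8]
-/

namespace Literature.Computability.Complexity

open Finset

section Transfer

variable (u v : ℝ)

/-- Weight of a vertex state: `w` if occupied, `1` otherwise. [folklore] -/
noncomputable def slyWt (w : ℝ) (b : Bool) : ℝ := if b = true then w else 1

/-- Hard-core constraint factor of an edge: `0` if both ends occupied, else `1`. [folklore] -/
noncomputable def slyOk (b₁ b₂ : Bool) : ℝ := if (b₁ && b₂) = true then 0 else 1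

/-- Occupied weight. [folklore] -/
@[simp] theorem slyWt_true (w : ℝ) : slyWt w true = w := by simp [slyWt]
/-- Unoccupied weight. [folklore] -/
@[simp] theorem slyWt_false (w : ℝ) : slyWt w false = 1 := by simp [slyWt]
/-- Both ends occupied is forbidden. [folklore] -/
@[simp] theorem slyOk_true_true : slyOk true true = 0 := by simp [slyOk]
/-- A free left end imposes nothing. [folklore] -/
@[simp] theorem slyOk_false_left (b : Bool) : slyOk false b = 1 := by simp [slyOk]
/-- A free right end imposes nothing. [folklore] -/
@[simp] theorem slyOk_false_right (b : Bool) : slyOk b false = 1 := by cases b <;> simp [slyOk]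

/-- The one-period transfer weight `N(b', b)` from the state of `v_t` to the state of `v_{t+1}`, summing
over the state `m` of `w_t`: `N = [[1+v, u], [1, u]]`. [cite: Sly2010, Lemma 3.8 (proof, after MWW09 Lemma 7.4: the transfer matrix of the cycle)] -/
noncomputable def slyN (b' b : Bool) : ℝ :=
  ∑ m : Bool, slyOk b' m * slyOk m b * slyWt v m * slyWt u b

/-- `N(0,0) = 1 + v`. [folklore] -/
theorem slyN_ff : slyN u v false false = 1 + v := by
  simp [slyN]; ring
/-- `N(0,1) = u`. [folklore] -/
theorem slyN_ft : slyN u v false true = u := by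
  simp [slyN, slyOk]
/-- `N(1,0) = 1`. [folklore] -/
theorem slyN_tf : slyN u v true false = 1 := by
  simp [slyN, slyOk]
/-- `N(1,1) = u`. [folklore] -/
theorem slyN_tt : slyN u v true true = u := by
  simp [slyN, slyOk]

/-- **Open-path transfer sums** `P_j(a, b)`: configurations of the path `v_0 w_0 v_1 ⋯ w_{j-1} v_j` with
no two adjacent occupied vertices, `v_0` in state `a` and `v_j` in state `b`, weighted `u` per occupied
`v_1, …, v_j` and `v` per occupied `w`; defined by the transfer recursion. [folklore] -/
noncomputable def slyP : ℕ → Bool → Bool → ℝ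
  | 0, a, b => if a = b then 1 else 0
  | j + 1, a, b => ∑ b' : Bool, slyP j a b' * slyN u v b' b

/-- `P_0 = I`. [folklore] -/
theorem slyP_zero (a b : Bool) : slyP u v 0 a b = if a = b then 1 else 0 := rfl
/-- `P_{j+1} = P_j N`. [folklore] -/
theorem slyP_succ (j : ℕ) (a b : Bool) : slyP u v (j + 1) a b = ∑ b' : Bool, slyP u v j a b' * slyN u v b' b := rfl

/-- **Cayley–Hamilton recursion**: `P_{j+2} = (tr N) P_{j+1} - (det N) P_j` entrywise, with
`tr N = 1 + u + v`, `det N = u v`. [folklore] -/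
theorem slyP_rec (j : ℕ) (a b : Bool) :
    slyP u v (j + 2) a b = (1 + u + v) * slyP u v (j + 1) a b - (u * v) * slyP u v j a b := by
  rw [slyP_succ, slyP_succ u v j a]
  simp only [Fintype.sum_bool, slyP_succ, slyN_ff, slyN_ft, slyN_tf, slyN_tt]
  cases b <;> simp only [slyN_ff, slyN_ft, slyN_tf, slyN_tt] <;> ring

/-- **The trace identity**: if `c (1 + u + v) = 1 + ρ` and `c² u v = ρ` then
`c^j (P_j(0,0) + P_j(1,1)) = 1 + ρ^j` for all `j` (with the convention `P_0 = I`, value `2` at `j = 0`). [folklore] -/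
theorem slyTransfer_trace {c ρ : ℝ} (h1 : c * (1 + u + v) = 1 + ρ) (h2 : c ^ 2 * (u * v) = ρ) :
    ∀ j : ℕ, c ^ j * (slyP u v j false false + slyP u v j true true) = 1 + ρ ^ j := by
  -- strong induction with the two-step recursion
  have key : ∀ j : ℕ, c ^ j * (slyP u v j false false + slyP u v j true true) = 1 + ρ ^ j ∧
      c ^ (j + 1) * (slyP u v (j + 1) false false + slyP u v (j + 1) true true) = 1 + ρ ^ (j + 1) := by
    intro j
    induction j with
    | zero =>
      constructor
      · simp [slyP_zero]
      · simp only [zero_add, pow_one, slyP_succ, Fintype.sum_bool, slyP_zero, slyN_ff, slyN_tt]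
        simp only [Bool.false_eq_true, if_false, if_true, Bool.true_eq_false, zero_mul, one_mul, zero_add, add_zero]
        linarith
    | succ j ih =>
      refine ⟨ih.2, ?_⟩
      have e := fun a b => slyP_rec u v j a b
      rw [show j + 1 + 1 = j + 2 by ring, e false false, e true true]
      have hj := ih.1
      have hj1 := ih.2
      -- `c^{j+2} (T P_{j+1} - D P_j) = (1+ρ)(1+ρ^{j+1}) - ρ (1 + ρ^j)`
      have : c ^ (j + 2) * ((1 + u + v) * slyP u v (j + 1) false false - u * v * slyP u v j false false +
          ((1 + u + v) * slyP u v (j + 1) true true - u * v * slyP u v j true true)) =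
          (c * (1 + u + v)) * (c ^ (j + 1) * (slyP u v (j + 1) false false + slyP u v (j + 1) true true)) -
            (c ^ 2 * (u * v)) * (c ^ j * (slyP u v j false false + slyP u v j true true)) := by ring
      rw [this, h1, h2, hj, hj1]
      ring
  exact fun j => (key j).1

end Transfer

section CycleSum

variable (u v : ℝ)

/-- **The cyclic hard-core sum of the `2j`-cycle** `v_0 w_0 v_1 ⋯ w_{j-1} (v_j = v_0)` in product form:
`Σ_{cp, cm} Π_t ok(v_t, w_t) ok(w_t, v_{t+1}) u^{[v_t]} v^{[w_t]}`. [cite: Sly2010, Lemma 3.8 (the vertex 2-colourings `ξ` with no two black adjacent)] -/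
noncomputable def slyCycleSum (j : ℕ) : ℝ :=
  ∑ cp : Fin j → Bool, ∑ cm : Fin j → Bool,
    ∏ t : Fin j, slyOk (cp t) (cm t) * slyOk (cm t) (cp (finRotate j t)) * slyWt u (cp t) * slyWt v (cm t)

/-- Open-path sums in product form: `v`-states `sp : Fin (j+1) → Bool`, `w`-states `sm : Fin j → Bool`,
endpoints prescribed, weight `u` on `v_1, …, v_j` only. [folklore] -/
noncomputable def slyPathSum (j : ℕ) (a b : Bool) : ℝ :=
  ∑ sp : Fin (j + 1) → Bool, ∑ sm : Fin j → Bool,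
    (if sp 0 = a then (1 : ℝ) else 0) * (if sp (Fin.last j) = b then (1 : ℝ) else 0) *
      ∏ t : Fin j, slyOk (sp t.castSucc) (sm t) * slyOk (sm t) (sp t.succ) * slyWt v (sm t) * slyWt u (sp t.succ)

/-- Sums over `Fin (n+1) → Bool` split off the last coordinate. [folklore] -/
theorem sum_fun_fin_succ_snoc {M : Type*} [AddCommMonoid M] (n : ℕ) (f : (Fin (n + 1) → Bool) → M) :
    ∑ g : Fin (n + 1) → Bool, f g = ∑ x : Bool, ∑ g : Fin n → Bool, f (Fin.snoc g x) := by
  rw [← (Fin.snocEquiv fun _ : Fin (n + 1) => Bool).sum_comp, Fintype.sum_prod_type]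
  rfl

/-- Selecting a Boolean value by an indicator sum. [folklore] -/
theorem sum_bool_ite_eq_mul (y : Bool) (g : Bool → ℝ) : ∑ b : Bool, (if y = b then (1 : ℝ) else 0) * g b = g y := by
  cases y <;> simp

/-- The summand of `slyPathSum (j+1)` at `sp = snoc sp' x`, `sm = snoc sm' m`. [folklore] -/
theorem slyPathSum_term (j : ℕ) (a b x m : Bool) (sp : Fin (j + 1) → Bool) (sm : Fin j → Bool) :
    (if (Fin.snoc sp x : Fin (j + 2) → Bool) 0 = a then (1 : ℝ) else 0) *
        (if (Fin.snoc sp x : Fin (j + 2) → Bool) (Fin.last (j + 1)) = b then (1 : ℝ) else 0) *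
      (∏ t : Fin (j + 1), slyOk ((Fin.snoc sp x : Fin (j + 2) → Bool) t.castSucc) ((Fin.snoc sm m : Fin (j + 1) → Bool) t) *
        slyOk ((Fin.snoc sm m : Fin (j + 1) → Bool) t) ((Fin.snoc sp x : Fin (j + 2) → Bool) t.succ) *
        slyWt v ((Fin.snoc sm m : Fin (j + 1) → Bool) t) * slyWt u ((Fin.snoc sp x : Fin (j + 2) → Bool) t.succ)) =
    (if sp 0 = a then (1 : ℝ) else 0) *
      (∏ t : Fin j, slyOk (sp t.castSucc) (sm t) * slyOk (sm t) (sp t.succ) * slyWt v (sm t) * slyWt u (sp t.succ)) *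
      ((if x = b then (1 : ℝ) else 0) * (slyOk (sp (Fin.last j)) m * slyOk m x * slyWt v m * slyWt u x)) := by
  have h0 : (Fin.snoc sp x : Fin (j + 2) → Bool) 0 = sp 0 := by
    rw [show (0 : Fin (j + 2)) = (0 : Fin (j + 1)).castSucc from rfl, Fin.snoc_castSucc]
  have hl : (Fin.snoc sp x : Fin (j + 2) → Bool) (Fin.last (j + 1)) = x := Fin.snoc_last _ _
  have hsc : ∀ t : Fin j, (Fin.snoc sp x : Fin (j + 2) → Bool) t.castSucc.succ = sp t.succ := by
    intro t; rw [Fin.succ_castSucc, Fin.snoc_castSucc]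
  rw [h0, hl, Fin.prod_univ_castSucc]
  simp only [Fin.snoc_castSucc, Fin.snoc_last, Fin.succ_last, hsc]
  ring

/-- **The combinatorial path sums satisfy the transfer recursion**:
`PathSum_{j+1}(a,b) = Σ_{b'} PathSum_j(a,b') N(b',b)`. [folklore] -/
theorem slyPathSum_succ (j : ℕ) (a b : Bool) :
    slyPathSum u v (j + 1) a b = ∑ b' : Bool, slyPathSum u v j a b' * slyN u v b' b := by
  have hL : slyPathSum u v (j + 1) a b = ∑ x : Bool, ∑ sp : Fin (j + 1) → Bool, ∑ m : Bool, ∑ sm : Fin j → Bool,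
      (if sp 0 = a then (1 : ℝ) else 0) *
        (∏ t : Fin j, slyOk (sp t.castSucc) (sm t) * slyOk (sm t) (sp t.succ) * slyWt v (sm t) * slyWt u (sp t.succ)) *
        ((if x = b then (1 : ℝ) else 0) * (slyOk (sp (Fin.last j)) m * slyOk m x * slyWt v m * slyWt u x)) := by
    unfold slyPathSum
    rw [sum_fun_fin_succ_snoc]
    refine Finset.sum_congr rfl fun x _ => Finset.sum_congr rfl fun sp _ => ?_
    rw [sum_fun_fin_succ_snoc]
    refine Finset.sum_congr rfl fun m _ => Finset.sum_congr rfl fun sm _ => ?_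
    exact slyPathSum_term u v j a b x m sp sm
  rw [hL]
  simp only [Fintype.sum_bool]
  unfold slyPathSum
  simp only [Finset.sum_mul, ← Finset.sum_add_distrib]
  refine Finset.sum_congr rfl fun sp _ => Finset.sum_congr rfl fun sm _ => ?_
  unfold slyN
  simp only [Fintype.sum_bool]
  cases sp (Fin.last j) <;> cases b <;> cases sp 0 <;> cases a <;> simp <;> ring

/-- The length-`0` path sum is the identity matrix. [folklore] -/
theorem slyPathSum_zero (a b : Bool) : slyPathSum u v 0 a b = if a = b then 1 else 0 := by
  unfold slyPathSum
  rw [sum_fun_fin_succ_snoc]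
  simp only [Finset.univ_eq_empty, Finset.prod_empty, mul_one, Fintype.sum_unique, Fintype.sum_bool]
  have h : ∀ (g : Fin 0 → Bool) (x : Bool), (Fin.snoc g x : Fin 1 → Bool) 0 = x := fun g x => by
    rw [show (0 : Fin 1) = Fin.last 0 from rfl, Fin.snoc_last]
  simp only [show (Fin.last 0) = (0 : Fin 1) from rfl, h]
  cases a <;> cases b <;> simp

/-- Hence the combinatorial path sums are the transfer-matrix entries. [folklore] -/
theorem slyPathSum_eq_slyP (j : ℕ) : ∀ a b : Bool, slyPathSum u v j a b = slyP u v j a b := by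
  induction j with
  | zero => intro a b; rw [slyPathSum_zero, slyP_zero]
  | succ j ih =>
    intro a b
    rw [slyPathSum_succ, slyP_succ]
    simp_rw [ih]

end CycleSum

section CycleClosing

variable (u v : ℝ)

/-- `finRotate` on a `castSucc` is `succ`. [folklore] -/
theorem finRotate_castSucc_eq (j : ℕ) (i : Fin j) : finRotate (j + 1) i.castSucc = i.succ := by
  have h := finRotate_of_lt (n := j) i.isLt
  apply Fin.ext
  have hv := congrArg Fin.val h
  rw [Fin.val_succ]
  exact hv

/-- Closing the path: appending the initial state reproduces the cyclic successor. [folklore] -/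
theorem snoc_self_succ (j : ℕ) (cp : Fin (j + 1) → Bool) (t : Fin (j + 1)) :
    (Fin.snoc cp (cp 0) : Fin (j + 2) → Bool) t.succ = cp (finRotate (j + 1) t) := by
  induction t using Fin.lastCases with
  | last => rw [Fin.succ_last, Fin.snoc_last, finRotate_last]
  | cast i => rw [Fin.succ_castSucc, Fin.snoc_castSucc, finRotate_castSucc_eq]

/-- The closed-path weight is the cyclic weight. [folklore] -/
theorem slyPath_closed_weight (j : ℕ) (cp cm : Fin (j + 1) → Bool) :
    (∏ t : Fin (j + 1), slyOk ((Fin.snoc cp (cp 0) : Fin (j + 2) → Bool) t.castSucc) (cm t) *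
        slyOk (cm t) ((Fin.snoc cp (cp 0) : Fin (j + 2) → Bool) t.succ) * slyWt v (cm t) *
        slyWt u ((Fin.snoc cp (cp 0) : Fin (j + 2) → Bool) t.succ)) =
      ∏ t : Fin (j + 1), slyOk (cp t) (cm t) * slyOk (cm t) (cp (finRotate (j + 1) t)) * slyWt u (cp t) * slyWt v (cm t) := by
  simp only [Fin.snoc_castSucc, snoc_self_succ]
  rw [Finset.prod_mul_distrib, Equiv.prod_comp (finRotate (j + 1)) (fun t => slyWt u (cp t)), ← Finset.prod_mul_distrib]
  refine Finset.prod_congr rfl fun t _ => ?_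
  ring

/-- **Closing the cycle**: the cyclic hard-core sum is the trace of the path sums,
`CycleSum_{j+1} = Σ_a PathSum_{j+1}(a, a)`. [cite: Sly2010, Lemma 3.8 (proof: the transfer-matrix trace over the rooted cycle)] -/
theorem slyCycleSum_eq_trace (j : ℕ) :
    slyCycleSum u v (j + 1) = ∑ a : Bool, slyPathSum u v (j + 1) a a := by
  have h1 : ∀ a : Bool, slyPathSum u v (j + 1) a a = ∑ x : Bool, ∑ cp : Fin (j + 1) → Bool, ∑ sm : Fin (j + 1) → Bool,
      (if cp 0 = a then (1 : ℝ) else 0) * (if x = a then (1 : ℝ) else 0) *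
        ∏ t : Fin (j + 1), slyOk ((Fin.snoc cp x : Fin (j + 2) → Bool) t.castSucc) (sm t) *
          slyOk (sm t) ((Fin.snoc cp x : Fin (j + 2) → Bool) t.succ) * slyWt v (sm t) * slyWt u ((Fin.snoc cp x : Fin (j + 2) → Bool) t.succ) := by
    intro a
    unfold slyPathSum
    rw [sum_fun_fin_succ_snoc]
    refine Finset.sum_congr rfl fun x _ => Finset.sum_congr rfl fun cp _ => Finset.sum_congr rfl fun sm _ => ?_
    have h0 : (Fin.snoc cp x : Fin (j + 2) → Bool) 0 = cp 0 := by
      rw [show (0 : Fin (j + 2)) = (0 : Fin (j + 1)).castSucc from rfl, Fin.snoc_castSucc]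
    have hl : (Fin.snoc cp x : Fin (j + 2) → Bool) (Fin.last (j + 1)) = x := Fin.snoc_last _ _
    rw [h0, hl]
  simp_rw [h1]
  simp only [Fintype.sum_bool]
  simp only [if_true, Bool.true_eq_false, Bool.false_eq_true, if_false, mul_zero, zero_mul, Finset.sum_const_zero,
    add_zero, zero_add, mul_one]
  unfold slyCycleSum
  rw [← Finset.sum_add_distrib]
  refine Finset.sum_congr rfl fun cp _ => ?_
  rw [← Finset.sum_add_distrib]
  refine Finset.sum_congr rfl fun cm _ => ?_
  cases h : cp 0
  · simp only [Bool.false_eq_true, if_false, zero_mul, if_true, one_mul, zero_add]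
    rw [← slyPath_closed_weight u v j cp cm, h]
  · simp only [if_true, one_mul, Bool.true_eq_false, if_false, zero_mul, add_zero]
    rw [← slyPath_closed_weight u v j cp cm, h]

/-- **The cycle identity** (the `1 + δ` of MWW09 Lemma 7.4 / Sly Lemma 3.8): if `c (1+u+v) = 1+ρ` and
`c² u v = ρ` then `c^{j+1} · CycleSum_{j+1}(u, v) = 1 + ρ^{j+1}`. [cite: Sly2010, Lemma 3.8 (`(1+δ_i)` with `δ_i = (αβ/((1-α)(1-β)))^{i/2}`)] -/
theorem slyCycleSum_identity {c ρ : ℝ} (h1 : c * (1 + u + v) = 1 + ρ) (h2 : c ^ 2 * (u * v) = ρ) (j : ℕ) :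
    c ^ (j + 1) * slyCycleSum u v (j + 1) = 1 + ρ ^ (j + 1) := by
  rw [slyCycleSum_eq_trace, Fintype.sum_bool, slyPathSum_eq_slyP, slyPathSum_eq_slyP]
  have h := slyTransfer_trace u v h1 h2 (j + 1)
  linarith [h]

/-- **Sly's constants**: with `u = α(1-α)/(1-α-β)²`, `v = β(1-β)/(1-α-β)²`, `c = (1-α-β)²/((1-α)(1-β))`,
`ρ = αβ/((1-α)(1-β))` the two relations hold. [cite: Sly2010, Lemma 3.8] -/
theorem sly_transfer_constants {α β : ℝ} (hα : α < 1) (hβ : β < 1) (hαβ : α + β < 1) :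
    ((1 - α - β) ^ 2 / ((1 - α) * (1 - β))) * (1 + α * (1 - α) / (1 - α - β) ^ 2 + β * (1 - β) / (1 - α - β) ^ 2) =
        1 + α * β / ((1 - α) * (1 - β)) ∧
      ((1 - α - β) ^ 2 / ((1 - α) * (1 - β))) ^ 2 * ((α * (1 - α) / (1 - α - β) ^ 2) * (β * (1 - β) / (1 - α - β) ^ 2)) =
        α * β / ((1 - α) * (1 - β)) := by
  have h1 : (1 - α) ≠ 0 := ne_of_gt (sub_pos.2 hα)
  have h2 : (1 - β) ≠ 0 := ne_of_gt (sub_pos.2 hβ)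
  have h3 : (1 - α - β) ≠ 0 := ne_of_gt (by linarith)
  constructor
  · field_simp
    ring
  · field_simp

end CycleClosing

end Literature.Computability.Complexity
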